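import Literature.Probability.LatticeModels.MeshStrayExtent
import Literature.Probability.RandomPlanarGeometry.ImageUnivalent
import HarnessLib

/-!
# Stray mesh components of a Jordan domain have small diameter
— (T) brick of line `symplectic-fermion-anchor`
(crux `SAWLoopFugacityFlow.AvoidanceLimit`, stmt-CriticalPhenomena-10649)

For a Jordan domain `N` and `L > 0` there is `ε > 0` such that for all small meshes `δ > 0`: if
`x`, `y` are mesh vertices of `N.carrier ∩ δℤ²` joined in the mesh graph on mesh vertices
(`meshVertexGraph`) and the component of `x` is `ε`-*stray* (every mesh vertex joined to `x` has
its mesh point within `ε` of `N.carrierᶜ`), then `dist (δx) (δy) < L`.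

Proof. The tree's `JordanDomain.mul_sub_lt_of_stray` (`MeshStrayExtent.lean`) is the horizontal
half: `δ (y₀ - x₀) < L/2`, and, strayness being a property of the whole component (`Reachable` is
symmetric and transitive), also `δ (x₀ - y₀) < L/2`. For the vertical half we transport the whole
configuration along the reflection in the diagonal: `S : z ↦ (im z) + i (re z)` on `ℂ` (a
real-linear isometric involution) and `(v₀, v₁) ↦ (v₁, v₀)` on `ℤ²`. Mesh points, mesh vertices,
mesh edges (`S` is affine, so it maps segments to segments, and a homeomorphism, so it maps
closures to closures), reachability in the mesh vertex graph (a graph homomorphism) and distances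
to the complement (`S` is a bijective isometry) are all transported (`mem_meshVertices_transport`,
`meshGraph_adj_transport`, `reachable_transport`), and the reflected domain `N.image S` is again a
Jordan domain (`JordanDomain.image`, `ImageUnivalent.lean`); the horizontal bound for `N.image S`
is the vertical bound for `N`. Finally `dist ≤ |Δ re| + |Δ im| < L/2 + L/2`.
Folklore; no definitions.
-/

noncomputable section

open scoped Topology
open Filter Literature.Probability.RandomPlanarGeometry Literature.Probability.LatticeModels

namespace Summit.CriticalPhenomena.SAWScalingLimit.Theorems.AvoidanceLimit.Anchor

/-! ### Transport of the discretisation along a lattice symmetry of the plane -/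

section Transport

variable {Ω Ω' : Set ℂ} {δ : ℝ} {cell : Site 2 → Site 2} {plane : ℂ ≃ₗᵢ[ℝ] ℂ}

/-- **Mesh vertices are transported.** If `plane` is a real-linear isometry of `ℂ` with
`plane '' Ω = Ω'` and `cell` a map of `ℤ²` with `meshPoint δ (cell v) = plane (meshPoint δ v)`,
then `cell` maps mesh vertices of `Ω` to mesh vertices of `Ω'`. [folklore] -/
theorem mem_meshVertices_transport (hΩ : plane '' Ω = Ω')
    (hpt : ∀ v : Site 2, meshPoint δ (cell v) = plane (meshPoint δ v)) {v : Site 2}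
    (hv : v ∈ meshVertices Ω δ) : cell v ∈ meshVertices Ω' δ := by
  subst hΩ
  rw [mem_meshVertices_iff, hpt]
  exact Set.mem_image_of_mem _ hv

/-- **Mesh edges are transported.** In the setting of `mem_meshVertices_transport`, if moreover
`cell` preserves adjacency in `ℤ²`, then it maps edges of the mesh graph of `Ω` to edges of the
mesh graph of `Ω'`: the closed segment `[δ cell x, δ cell y] = plane '' [δx, δy]` lies in
`plane '' closure Ω = closure Ω'`. [folklore] -/
theorem meshGraph_adj_transport (hΩ : plane '' Ω = Ω')
    (hadj : ∀ x y : Site 2, (zdGraph 2).Adj x y → (zdGraph 2).Adj (cell x) (cell y))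
    (hpt : ∀ v : Site 2, meshPoint δ (cell v) = plane (meshPoint δ v)) {x y : Site 2}
    (h : (meshGraph Ω δ).Adj x y) : (meshGraph Ω' δ).Adj (cell x) (cell y) := by
  subst hΩ
  rw [meshGraph_adj_iff] at h ⊢
  refine ⟨hadj x y h.1, ?_⟩
  have hseg : plane '' segment ℝ (meshPoint δ x) (meshPoint δ y) =
      segment ℝ (plane (meshPoint δ x)) (plane (meshPoint δ y)) := by
    simpa using image_segment ℝ plane.toLinearEquiv.toLinearMap.toAffineMap (meshPoint δ x)
      (meshPoint δ y)
  have hcl : closure (plane '' Ω) = plane '' closure Ω := (plane.toHomeomorph.image_closure Ω).symm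
  rw [hpt, hpt, ← hseg, hcl]
  exact Set.image_mono h.2

/-- **Reachability is transported.** In the setting of `meshGraph_adj_transport`, `cell` induces
a homomorphism of the mesh graphs on mesh vertices, hence maps joined mesh vertices of `Ω` to
joined mesh vertices of `Ω'`. [folklore] -/
theorem reachable_transport (hΩ : plane '' Ω = Ω')
    (hadj : ∀ x y : Site 2, (zdGraph 2).Adj x y → (zdGraph 2).Adj (cell x) (cell y))
    (hpt : ∀ v : Site 2, meshPoint δ (cell v) = plane (meshPoint δ v)) {x y : Site 2}
    (hx : x ∈ meshVertices Ω δ) (hy : y ∈ meshVertices Ω δ)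
    (h : (meshVertexGraph Ω δ).Reachable ⟨x, hx⟩ ⟨y, hy⟩) :
    (meshVertexGraph Ω' δ).Reachable ⟨cell x, mem_meshVertices_transport hΩ hpt hx⟩
      ⟨cell y, mem_meshVertices_transport hΩ hpt hy⟩ := by
  let φ : meshVertexGraph Ω δ →g meshVertexGraph Ω' δ :=
    { toFun := fun v => ⟨cell v, mem_meshVertices_transport hΩ hpt v.2⟩
      map_rel' := fun hab => meshGraph_adj_transport hΩ hadj hpt hab }
  exact h.map φ

end Transport

/-- **The reflection in the diagonal is a linear isometry.** The map `z ↦ (im z) + i (re z)`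
(`= i z̄`) is a real-linear isometric equivalence of `ℂ`. [folklore] -/
theorem exists_linearIsometryEquiv_swap :
    ∃ S : ℂ ≃ₗᵢ[ℝ] ℂ, (∀ z, (S z).re = z.im) ∧ ∀ z, (S z).im = z.re :=
  ⟨{ toFun := fun z => ⟨z.im, z.re⟩
     invFun := fun z => ⟨z.im, z.re⟩
     map_add' := fun a b => Complex.ext (by simp) (by simp)
     map_smul' := fun c a => Complex.ext (by simp) (by simp)
     left_inv := fun z => Complex.ext rfl rfl
     right_inv := fun z => Complex.ext rfl rfl
     norm_map' := fun z => by
       change ‖(⟨z.im, z.re⟩ : ℂ)‖ = ‖z‖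
       simp only [Complex.norm_def, Complex.normSq_apply]
       rw [add_comm] },
    fun _ => rfl, fun _ => rfl⟩

/-! ### The theorem -/

/-- **Stray mesh components have small diameter.** For a Jordan domain `N` and `L > 0` there is
`ε > 0` such that for all sufficiently small meshes `δ > 0`: if the mesh vertices `x`, `y` of
`N.carrier ∩ δℤ²` are joined in the mesh graph on mesh vertices and every mesh vertex joined to
`x` has its mesh point within `ε` of `N.carrierᶜ` (the component of `x` is `ε`-stray), then
`dist (δx) (δy) < L`. The horizontal extent is `JordanDomain.mul_sub_lt_of_stray` (applied to
`(x, y)` and to `(y, x)`); the vertical extent is the same theorem for the domain reflected in the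
diagonal (`JordanDomain.image` along `exists_linearIsometryEquiv_swap`, the configuration being
transported by `reachable_transport`); and `dist ≤ |Δ re| + |Δ im|`. [folklore] -/
theorem meshStray_dist_lt :
    ∀ (N : JordanDomain) (L : ℝ), 0 < L → ∃ ε : ℝ, 0 < ε ∧ ∀ᶠ δ in 𝓝[>] (0 : ℝ),
      ∀ x y : ↥(meshVertices N.carrier δ), (meshVertexGraph N.carrier δ).Reachable x y →
        (∀ z : ↥(meshVertices N.carrier δ), (meshVertexGraph N.carrier δ).Reachable x z →
          Metric.infDist (meshPoint δ (z : Site 2)) N.carrierᶜ < ε) →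
        dist (meshPoint δ (x : Site 2)) (meshPoint δ (y : Site 2)) < L := by
  intro N L hL
  have hL2 : 0 < L / 2 := by positivity
  -- the reflection in the diagonal, on the plane and on the lattice
  obtain ⟨S, hSre, hSim⟩ := exists_linearIsometryEquiv_swap
  have hSS : ∀ z, S (S z) = z := fun z =>
    Complex.ext (by rw [hSre, hSim]) (by rw [hSim, hSre])
  have hSset : ∀ A : Set ℂ, S '' (S '' A) = A := fun A =>
    Function.LeftInverse.image_image hSS A
  obtain ⟨sw, hsw0, hsw1⟩ : ∃ sw : Site 2 → Site 2, (∀ v, sw v 0 = v 1) ∧ ∀ v, sw v 1 = v 0 :=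
    ⟨fun v => ![v 1, v 0], fun _ => rfl, fun _ => rfl⟩
  have hswsw : ∀ v, sw (sw v) = v := fun v => by
    ext k; fin_cases k <;> simp [hsw0, hsw1]
  have hpt : ∀ (δ : ℝ) (v : Site 2), meshPoint δ (sw v) = S (meshPoint δ v) := fun δ v => by
    apply Complex.ext
    · rw [meshPoint_re, hSre, meshPoint_im, hsw0]
    · rw [meshPoint_im, hSim, meshPoint_re, hsw1]
  have hswadj : ∀ a b : Site 2, (zdGraph 2).Adj a b → (zdGraph 2).Adj (sw a) (sw b) := by
    have key : ∀ (c : Site 2) (i : Fin 2), ∃ j : Fin 2,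
        sw (c + Pi.single i 1) = sw c + Pi.single j 1 := by
      intro c i
      fin_cases i
      · exact ⟨1, by ext k; fin_cases k <;> simp [hsw0, hsw1]⟩
      · exact ⟨0, by ext k; fin_cases k <;> simp [hsw0, hsw1]⟩
    intro a b h
    rw [zdGraph_adj_iff] at h ⊢
    obtain ⟨i, rfl | rfl⟩ := h
    · obtain ⟨j, hj⟩ := key a i
      exact ⟨j, Or.inl hj⟩
    · obtain ⟨j, hj⟩ := key b i
      exact ⟨j, Or.inr hj⟩
  have hinf : ∀ p : ℂ, Metric.infDist (S p) N.carrierᶜ = Metric.infDist p (S '' N.carrier)ᶜ := by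
    intro p
    have h := Metric.infDist_image (x := p) (t := S '' N.carrierᶜ) S.isometry
    rwa [hSset, Set.image_compl_eq S.bijective] at h
  -- the horizontal extent of stray components of `N` and of the reflected domain `N'`
  obtain ⟨ε₁, hε₁, δ₁, hδ₁, H₁⟩ := N.mul_sub_lt_of_stray hL2
  set N' : JordanDomain := N.image S S.continuous.continuousOn S.injective.injOn
  have hΩ : S '' N.carrier = N'.carrier := rfl
  have hΩ' : S '' N'.carrier = N.carrier := hSset N.carrier
  obtain ⟨ε₂, hε₂, δ₂, hδ₂, H₂⟩ := N'.mul_sub_lt_of_stray hL2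
  refine ⟨min ε₁ ε₂, lt_min hε₁ hε₂, ?_⟩
  filter_upwards [Ioo_mem_nhdsGT (lt_min hδ₁ hδ₂)] with δ hδ
  have hδ0 : 0 < δ := hδ.1
  have hδ1 : δ < δ₁ := hδ.2.trans_le (min_le_left _ _)
  have hδ2 : δ < δ₂ := hδ.2.trans_le (min_le_right _ _)
  intro x y hxy hstray
  have hstray_y : ∀ z : ↥(meshVertices N.carrier δ), (meshVertexGraph N.carrier δ).Reachable y z →
      Metric.infDist (meshPoint δ (z : Site 2)) N.carrierᶜ < min ε₁ ε₂ := fun z hz =>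
    hstray z (hxy.trans hz)
  -- horizontal extent
  have h1 : δ * (((y : Site 2) 0 : ℝ) - ((x : Site 2) 0 : ℝ)) < L / 2 :=
    H₁ δ hδ0 hδ1 x y hxy fun z hz => (hstray z hz).trans_le (min_le_left _ _)
  have h2 : δ * (((x : Site 2) 0 : ℝ) - ((y : Site 2) 0 : ℝ)) < L / 2 :=
    H₁ δ hδ0 hδ1 y x hxy.symm fun z hz => (hstray_y z hz).trans_le (min_le_left _ _)
  -- vertical extent: transport to the reflected domain
  have hxmem : sw (x : Site 2) ∈ meshVertices N'.carrier δ :=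
    mem_meshVertices_transport hΩ (hpt δ) x.2
  have hymem : sw (y : Site 2) ∈ meshVertices N'.carrier δ :=
    mem_meshVertices_transport hΩ (hpt δ) y.2
  have hxy' : (meshVertexGraph N'.carrier δ).Reachable ⟨sw x, hxmem⟩ ⟨sw y, hymem⟩ :=
    reachable_transport hΩ hswadj (hpt δ) x.2 y.2 hxy
  have hstray' : ∀ z' : ↥(meshVertices N'.carrier δ),
      (meshVertexGraph N'.carrier δ).Reachable ⟨sw x, hxmem⟩ z' →
        Metric.infDist (meshPoint δ (z' : Site 2)) N'.carrierᶜ < ε₂ := by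
    intro z' hz'
    have hr := reachable_transport hΩ' hswadj (hpt δ) hxmem z'.2 hz'
    have hxe : (⟨sw (sw (x : Site 2)), mem_meshVertices_transport hΩ' (hpt δ) hxmem⟩ :
        ↥(meshVertices N.carrier δ)) = x := Subtype.ext (hswsw x)
    rw [hxe] at hr
    have h5 := hstray _ hr
    dsimp only at h5
    rw [hpt, hinf] at h5
    exact h5.trans_le (min_le_right _ _)
  have hstray'_y : ∀ z' : ↥(meshVertices N'.carrier δ),
      (meshVertexGraph N'.carrier δ).Reachable ⟨sw y, hymem⟩ z' →
        Metric.infDist (meshPoint δ (z' : Site 2)) N'.carrierᶜ < ε₂ := fun z' hz' =>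
    hstray' z' (hxy'.trans hz')
  have h3 := H₂ δ hδ0 hδ2 ⟨sw x, hxmem⟩ ⟨sw y, hymem⟩ hxy' hstray'
  have h4 := H₂ δ hδ0 hδ2 ⟨sw y, hymem⟩ ⟨sw x, hxmem⟩ hxy'.symm hstray'_y
  dsimp only at h3 h4
  rw [hsw0, hsw0] at h3 h4
  -- conclusion
  rw [Complex.dist_eq]
  refine (Complex.norm_le_abs_re_add_abs_im _).trans_lt ?_
  rw [Complex.sub_re, Complex.sub_im, meshPoint_re, meshPoint_re, meshPoint_im, meshPoint_im]
  have hA : |δ * ((x : Site 2) 0 : ℝ) - δ * ((y : Site 2) 0 : ℝ)| < L / 2 := by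
    rw [abs_sub_lt_iff, ← mul_sub, ← mul_sub]
    exact ⟨h2, h1⟩
  have hB : |δ * ((x : Site 2) 1 : ℝ) - δ * ((y : Site 2) 1 : ℝ)| < L / 2 := by
    rw [abs_sub_lt_iff, ← mul_sub, ← mul_sub]
    exact ⟨h4, h3⟩
  linarith

end Summit.CriticalPhenomena.SAWScalingLimit.Theorems.AvoidanceLimit.Anchor

end
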